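import Summits.AtomisticToContinuum.HydrodynamicLimit.Theorems.BoxDissipativeWeakStrongRelativeEnergyStabilityClampChoice
import Summits.AtomisticToContinuum.HydrodynamicLimit.Theorems.BoxDissipativeWeakStrongRelativeEnergyStabilityTimeZero
import Summits.AtomisticToContinuum.HydrodynamicLimit.Theorems.BoxDissipativeWeakStrongRelativeEnergyStabilityBalanceLaws
import Summits.AtomisticToContinuum.HydrodynamicLimit.Theorems.BoxDissipativeWeakStrongRelativeEnergyStabilityEnergyMoment
import Summits.AtomisticToContinuum.HydrodynamicLimit.Theorems.BoxDissipativeWeakStrongRelativeEnergyStabilityCutEosMaster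
import Summits.AtomisticToContinuum.HydrodynamicLimit.Theorems.BoxDissipativeWeakStrongRelativeEnergyStabilityCoercive
import Summits.AtomisticToContinuum.HydrodynamicLimit.Theorems.BoxDissipativeWeakStrongRelativeEnergyStabilityForcedGronwall
import Summits.AtomisticToContinuum.HydrodynamicLimit.Theorems.BoxDissipativeWeakStrongRelativeEnergyStabilityFlowJointMeasurable
import Summits.AtomisticToContinuum.HydrodynamicLimit.Theorems.BoxDissipativeWeakStrongRelativeEnergyStabilityGronwall
import HarnessLib

/-!
# Crux `RelativeEnergyStability` (stmt-AtomisticToContinuum-17653) of route `BoxDissipativeWeakStrong` — PROVED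
# (line `registered`, lead prover; Březina–Feireisl weak–strong stability in expectation, clamped currency)

`RelativeEnergyStability_proof : BoxDissipativeWeakStrong.RelativeEnergyStability` — the route's crux BY NAME.

The line (skeleton `Cruxes/RelativeEnergyStability/Lines/birth.lean`, reshaped by the lead to the CLAMPED relative energy
`ℰ_{Z_{a,b}}` of the cut hard-sphere law with a deep lower clamp) decomposes the crux into nine stubs, all landed under
`Theorems/BoxDissipativeWeakStrongRelativeEnergyStability*.lean` (namespace `…Theorems.RES`):
S0 `stub_clampChoice` (admissible deep clamps), S1' `stub_clampedRelEnergyTimeZero` (statics at `t = 0` by dominated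
convergence), S-B `stub_boxBalanceLaws` (exact box balance laws along good orbits), S-M `stub_cutEosMaster` (BF's master
pointwise inequality for the cut law), S-E `stub_localGibbsEnergyMoment` (energy moment bound), S-G `stub_forcedGronwall`
(Grönwall with `o(1)` forcing), S-J `stub_flowJointMeasurable` (jointly measurable version of the flow), S-X
`stub_clampedRelEnergyGronwall` (THE HEART: the clamped relative-energy Grönwall in expectation, from `FluxClosure` tested
with `w = u`, `EntropyAdmissibility` tested with `φ = θ`, the balance laws and the master inequality) and S3'
`stub_clampedRelEnergyCoercive` (coercivity: clamped vanishing ⇒ hydrodynamic fields converge).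

This file is the sorry-free COMPOSITION (`RelativeEnergyStability_of`, verbatim §2 of the registered skeleton): common band
threshold, common density threshold (with the crux's own inlined `LocalGibbsFineScale` antecedent), a kinetic window
(`exists_isKineticWindow`), admissible clamps on `[0,t]`, and the chain S3' ∘ S-X ∘ S1' ∘ K0 at each `t ∈ [0,T)`.

References: J. Březina, E. Feireisl, *Measure-valued solutions to the complete Euler system*, J. Math. Soc. Japan 70 (2018)
§3.2; H. Spohn, *Large Scale Dynamics of Interacting Particles* (1991), Part I Ch. 3.
-/

noncomputable section

open MeasureTheory Filter Set
open scoped ENNReal Topology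

namespace Summit.AtomisticToContinuum.HydrodynamicLimit.Theorems

namespace RES

open Literature.MathematicalPhysics.KineticTheory Literature.Analysis.FluidPDE
open Literature.Analysis.FluidPDE.CompressibleEuler
open Literature.Analysis.FluidPDE.CompressibleEuler.EulerPhase
open Literature.Analysis.FunctionSpaces
open Summit.AtomisticToContinuum.HydrodynamicLimit.Theses
open Summit.AtomisticToContinuum.HydrodynamicLimit.Theses.BoxDissipativeWeakStrong

/-! ## The composition (verbatim §2 of the registered skeleton) -/

/-- **A kinetic window exists**: `ℓ_N = (N+1)^{-1/4}` satisfies `0 < ℓ_N ≤ 1`, `ℓ_N → 0` and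
`(N+1)ℓ_N³ = (N+1)^{1/4} → ∞`. -/
theorem exists_isKineticWindow : ∃ ℓ : ℕ → ℝ, IsKineticWindow ℓ := by
  refine ⟨fun N => ((N : ℝ) + 1) ^ (-(1 / 4 : ℝ)), fun N => ⟨?_, ?_⟩, ?_, ?_⟩
  · exact Real.rpow_pos_of_pos (by positivity) _
  · exact Real.rpow_le_one_of_one_le_of_nonpos (by simp) (by norm_num)
  · have h1 : Tendsto (fun N : ℕ => (N : ℝ) + 1) atTop atTop :=
      tendsto_atTop_add_const_right _ 1 tendsto_natCast_atTop_atTop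
    exact (tendsto_rpow_neg_atTop (by norm_num : (0 : ℝ) < 1 / 4)).comp h1
  · have h1 : Tendsto (fun N : ℕ => (N : ℝ) + 1) atTop atTop :=
      tendsto_atTop_add_const_right _ 1 tendsto_natCast_atTop_atTop
    have h2 : Tendsto (fun N : ℕ => ((N : ℝ) + 1) ^ (1 / 4 : ℝ)) atTop atTop :=
      (tendsto_rpow_atTop (by norm_num : (0 : ℝ) < 1 / 4)).comp h1
    refine h2.congr' (Eventually.of_forall fun N => ?_)
    have hx : (0 : ℝ) < (N : ℝ) + 1 := by positivity
    simp only
    rw [← Real.rpow_natCast (((N : ℝ) + 1) ^ (-(1 / 4 : ℝ))) 3, ← Real.rpow_mul hx.le,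
      ← Real.rpow_add_one hx.ne']
    norm_num

/-- **The line closes the crux modulo its stubs**: `RelativeEnergyStability` BY NAME from the stubs (used as
hypotheses through their declared statements). Real content: the common band threshold
`min ηe (min ηa (min ηb ηd))` (S-B, S-M, S-E are consumed by S-X), the common density threshold
`min (1/2) (min σK σ₂)` with `σK` from the crux's OWN inlined `LocalGibbsFineScale` antecedent, `0 < T` from
`t ∈ [0,T)`, a kinetic window (`exists_isKineticWindow`), admissible clamps on `[0,t]` from S0 (restricted to
`[0,0]` for S1' by `clampAdmissible_mono`), and the chaining S3' ∘ S-X ∘ S1' ∘ K0 at each `t`. -/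
theorem RelativeEnergyStability_of
    (hmono : ∀ {σ η₁ a b : ℝ} {ρ θ : ℝ → T3 → ℝ} {τ τ' : ℝ},
      ClampAdmissible σ η₁ a b ρ θ τ → τ' ≤ τ → ClampAdmissible σ η₁ a b ρ θ τ')
    (h₀ : HsEosLowDensity →
      ∃ ηe : ℝ, 0 < ηe ∧ ∀ η₁ : ℝ, 0 < η₁ → η₁ < ηe → ∀ σ : ℝ, 0 < σ →
        ∀ (T : ℝ) (ρ θ : ℝ → T3 → ℝ) (u : ℝ → T3 → V3), IsHardSphereEulerSolution σ T ρ u θ →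
          (∀ t ∈ Ico 0 T, ∀ x, ρ t x * σ ^ 3 ≤ η₁ / 2) →
          ∀ τ ∈ Ico 0 T, ∃ a b : ℝ, ClampAdmissible σ η₁ a b ρ θ τ)
    (h₁ : HsEosLowDensity →
      ∃ ηa : ℝ, 0 < ηa ∧ ∀ η₁ : ℝ, 0 < η₁ → η₁ < ηa →
        ∀ (a₀ θ₀ : T3 → ℝ) (u₀ : T3 → V3), Continuous a₀ → Continuous θ₀ → Continuous u₀ →
          (∀ x, 0 < a₀ x) → (∀ x, 0 < θ₀ x) →
          ∀ σ : ℝ, 0 < σ → σ ≤ 1 / 2 →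
            ∀ (T : ℝ) (ρ θ : ℝ → T3 → ℝ) (u : ℝ → T3 → V3), IsHardSphereEulerSolution σ T ρ u θ → 0 < T →
              ∀ Φ : (N : ℕ) → HardSphereFlow (Literature.Analysis.FluidPDE.Torus.geometry (Fin 3))
                  (hsDiameter σ N) (N + 1),
                ∀ ℓ : ℕ → ℝ, IsKineticWindow ℓ →
                  ∀ a b : ℝ, ClampAdmissible σ η₁ a b ρ θ 0 →
                    BoxFieldsL1At σ a₀ u₀ θ₀ Φ ρ u θ ℓ 0 →
                      BoxClampedRelEnergyVanishesAt σ η₁ a b a₀ u₀ θ₀ Φ ρ u θ ℓ 0)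
    (hB : ∀ σ : ℝ, 0 < σ → ∀ (N : ℕ)
      (Φ : HardSphereFlow (Literature.Analysis.FluidPDE.Torus.geometry (Fin 3)) (hsDiameter σ N) (N + 1))
      (l : ℝ), 0 < l → l ≤ 1 → ∀ z ∈ Φ.good, BoxBalanceLawsFor σ N Φ l z)
    (hM : HsEosLowDensity →
      ∃ ηm : ℝ, 0 < ηm ∧ ∀ η₁ : ℝ, 0 < η₁ → η₁ < ηm → ∀ σ : ℝ, 0 < σ → CutEosMasterFor σ η₁)
    (hE : ∀ (a₀ θ₀ : T3 → ℝ) (u₀ : T3 → V3), Continuous a₀ → Continuous θ₀ → Continuous u₀ →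
      (∀ x, 0 < a₀ x) → (∀ x, 0 < θ₀ x) → EnergyMomentFor a₀ u₀ θ₀)
    (hG : (∀ (f err : ℕ → ℝ → ℝ) (τ C B : ℝ), 0 ≤ τ → 0 ≤ C →
        (∀ N, ∀ t ∈ Icc 0 τ, |f N t| ≤ B) → (∀ N, Measurable (f N)) →
        (∀ N, ∀ t ∈ Icc 0 τ, f N t ≤ f N 0 + C * (∫ s in (0:ℝ)..t, f N s) + err N t) →
        (∀ t ∈ Icc 0 τ, Tendsto (fun N => err N t) atTop (𝓝 0)) →
        Tendsto (fun N => f N 0) atTop (𝓝 0) →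
        ∀ t ∈ Icc 0 τ, ∀ ε > (0:ℝ), ∀ᶠ N in atTop, f N t ≤ ε))
    (hJ : (∀ (ε : ℝ) (n : ℕ) (Φ : HardSphereFlow (Literature.Analysis.FluidPDE.Torus.geometry (Fin 3)) ε n),
        ∃ Ψ : ℝ × Config n (Fin 3) T3 → Config n (Fin 3) T3, Measurable Ψ ∧
          ∀ (t : ℝ), ∀ z ∈ Φ.good, Ψ (t, z) = Φ.flow t z))
    (h₂ : (∀ (f err : ℕ → ℝ → ℝ) (τ C B : ℝ), 0 ≤ τ → 0 ≤ C →
        (∀ N, ∀ t ∈ Icc 0 τ, |f N t| ≤ B) → (∀ N, Measurable (f N)) →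
        (∀ N, ∀ t ∈ Icc 0 τ, f N t ≤ f N 0 + C * (∫ s in (0:ℝ)..t, f N s) + err N t) →
        (∀ t ∈ Icc 0 τ, Tendsto (fun N => err N t) atTop (𝓝 0)) →
        Tendsto (fun N => f N 0) atTop (𝓝 0) →
        ∀ t ∈ Icc 0 τ, ∀ ε > (0:ℝ), ∀ᶠ N in atTop, f N t ≤ ε) →
      (∀ (ε : ℝ) (n : ℕ) (Φ : HardSphereFlow (Literature.Analysis.FluidPDE.Torus.geometry (Fin 3)) ε n),
        ∃ Ψ : ℝ × Config n (Fin 3) T3 → Config n (Fin 3) T3, Measurable Ψ ∧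
          ∀ (t : ℝ), ∀ z ∈ Φ.good, Ψ (t, z) = Φ.flow t z) →
      (∀ σ : ℝ, 0 < σ → ∀ (N : ℕ)
        (Φ : HardSphereFlow (Literature.Analysis.FluidPDE.Torus.geometry (Fin 3)) (hsDiameter σ N) (N + 1))
        (l : ℝ), 0 < l → l ≤ 1 → ∀ z ∈ Φ.good, BoxBalanceLawsFor σ N Φ l z) →
      (HsEosLowDensity →
        ∃ ηm : ℝ, 0 < ηm ∧ ∀ η₁ : ℝ, 0 < η₁ → η₁ < ηm → ∀ σ : ℝ, 0 < σ → CutEosMasterFor σ η₁) →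
      (∀ (a₀ θ₀ : T3 → ℝ) (u₀ : T3 → V3), Continuous a₀ → Continuous θ₀ → Continuous u₀ →
        (∀ x, 0 < a₀ x) → (∀ x, 0 < θ₀ x) → EnergyMomentFor a₀ u₀ θ₀) →
      FluxClosure → EntropyAdmissibility → HsEosLowDensity →
        ∃ ηb : ℝ, 0 < ηb ∧ ∀ η₁ : ℝ, 0 < η₁ → η₁ < ηb →
          ∀ (a₀ θ₀ : T3 → ℝ) (u₀ : T3 → V3), Continuous a₀ → Continuous θ₀ → Continuous u₀ →
            (∀ x, 0 < a₀ x) → (∀ x, 0 < θ₀ x) →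
            ∃ σ₀ : ℝ, 0 < σ₀ ∧ ∀ σ : ℝ, 0 < σ → σ < σ₀ →
              ∀ (T : ℝ) (ρ θ : ℝ → T3 → ℝ) (u : ℝ → T3 → V3), IsHardSphereEulerSolution σ T ρ u θ →
                (∀ t ∈ Ico 0 T, ∀ x, ρ t x * σ ^ 3 ≤ η₁ / 2) →
                ∀ Φ : (N : ℕ) → HardSphereFlow (Literature.Analysis.FluidPDE.Torus.geometry (Fin 3))
                    (hsDiameter σ N) (N + 1),
                  TendstoHydroFieldsAt (fun N => localGibbsLaw σ a₀ u₀ θ₀ N (Φ N)) Φ ρ u θ 0 →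
                    ∀ ℓ : ℕ → ℝ, IsKineticWindow ℓ →
                      ∀ τ ∈ Ico 0 T, ∀ a b : ℝ, ClampAdmissible σ η₁ a b ρ θ τ →
                        BoxClampedRelEnergyVanishesAt σ η₁ a b a₀ u₀ θ₀ Φ ρ u θ ℓ 0 →
                          BoxClampedRelEnergyVanishesAt σ η₁ a b a₀ u₀ θ₀ Φ ρ u θ ℓ τ)
    (h₃ : HsEosLowDensity →
      ∃ ηd : ℝ, 0 < ηd ∧ ∀ η₁ : ℝ, 0 < η₁ → η₁ < ηd →
        ∀ (a₀ θ₀ : T3 → ℝ) (u₀ : T3 → V3), Continuous a₀ → Continuous θ₀ → Continuous u₀ →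
          (∀ x, 0 < a₀ x) → (∀ x, 0 < θ₀ x) →
          ∀ σ : ℝ, 0 < σ → σ ≤ 1 / 2 →
            ∀ (T : ℝ) (ρ θ : ℝ → T3 → ℝ) (u : ℝ → T3 → V3), IsHardSphereEulerSolution σ T ρ u θ →
              ∀ Φ : (N : ℕ) → HardSphereFlow (Literature.Analysis.FluidPDE.Torus.geometry (Fin 3))
                  (hsDiameter σ N) (N + 1),
                ∀ ℓ : ℕ → ℝ, IsKineticWindow ℓ →
                  ∀ t ∈ Ico 0 T, ∀ a b : ℝ, ClampAdmissible σ η₁ a b ρ θ t →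
                    BoxClampedRelEnergyVanishesAt σ η₁ a b a₀ u₀ θ₀ Φ ρ u θ ℓ t →
                      TendstoHydroFieldsAt (fun N => localGibbsLaw σ a₀ u₀ θ₀ N (Φ N)) Φ ρ u θ t) :
    BoxDissipativeWeakStrong.RelativeEnergyStability := by
  intro hFC hEA hK0 hEos
  obtain ⟨ηe, hηe, H₀⟩ := h₀ hEos
  obtain ⟨ηa, hηa, H₁⟩ := h₁ hEos
  obtain ⟨ηb, hηb, H₂⟩ := h₂ hG hJ hB hM hE hFC hEA hEos
  obtain ⟨ηd, hηd, H₃⟩ := h₃ hEos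
  refine ⟨min ηe (min ηa (min ηb ηd)), lt_min hηe (lt_min hηa (lt_min hηb hηd)), ?_⟩
  intro η₁ hη₁ hη₁lt a₀ θ₀ u₀ ha hθ hu hap hθp
  have hη₁e : η₁ < ηe := lt_of_lt_of_le hη₁lt (min_le_left _ _)
  have hη₁a : η₁ < ηa := lt_of_lt_of_le hη₁lt ((min_le_right _ _).trans (min_le_left _ _))
  have hη₁b : η₁ < ηb :=
    lt_of_lt_of_le hη₁lt ((min_le_right _ _).trans ((min_le_right _ _).trans (min_le_left _ _)))
  have hη₁d : η₁ < ηd :=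
    lt_of_lt_of_le hη₁lt ((min_le_right _ _).trans ((min_le_right _ _).trans (min_le_right _ _)))
  obtain ⟨σK, hσK, GK⟩ := hK0 a₀ θ₀ u₀ ha hθ hu hap hθp
  obtain ⟨σ₂, hσ₂, G₂⟩ := H₂ η₁ hη₁ hη₁b a₀ θ₀ u₀ ha hθ hu hap hθp
  refine ⟨min (1 / 2) (min σK σ₂), lt_min one_half_pos (lt_min hσK hσ₂), ?_⟩
  intro σ hσ hσlt T ρ θ u hsol hguard Φ h0 t ht
  have hσhalf : σ ≤ 1 / 2 := (lt_of_lt_of_le hσlt (min_le_left _ _)).le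
  have hσK' : σ < σK := lt_of_lt_of_le hσlt ((min_le_right _ _).trans (min_le_left _ _))
  have hσ₂' : σ < σ₂ := lt_of_lt_of_le hσlt ((min_le_right _ _).trans (min_le_right _ _))
  have hT : 0 < T := lt_of_le_of_lt ht.1 ht.2
  obtain ⟨ℓ, hℓ⟩ := exists_isKineticWindow
  -- admissible deep clamps on `[0,t]` (S0), restricted to `[0,0]` for the statics
  obtain ⟨a, b, hab⟩ := H₀ η₁ hη₁ hη₁e σ hσ T ρ θ u hsol hguard t ht
  have hab0 : ClampAdmissible σ η₁ a b ρ θ 0 := hmono hab ht.1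
  -- the crux's own fine-scale LLN antecedent (K0), at this window
  have hL1 : BoxFieldsL1At σ a₀ u₀ θ₀ Φ ρ u θ ℓ 0 :=
    GK σ hσ hσK' T ρ θ u hsol hT Φ h0 ℓ hℓ.1 hℓ.2.1 hℓ.2.2
  -- S1': statics by dominated convergence at t = 0
  have h0rel : BoxClampedRelEnergyVanishesAt σ η₁ a b a₀ u₀ θ₀ Φ ρ u θ ℓ 0 :=
    H₁ η₁ hη₁ hη₁a a₀ θ₀ u₀ ha hθ hu hap hθp σ hσ hσhalf T ρ θ u hsol hT Φ ℓ hℓ a b hab0 hL1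
  -- S-X: BF18 clamped Grönwall in expectation
  have htrel : BoxClampedRelEnergyVanishesAt σ η₁ a b a₀ u₀ θ₀ Φ ρ u θ ℓ t :=
    G₂ σ hσ hσ₂' T ρ θ u hsol hguard Φ h0 ℓ hℓ t ht a b hab h0rel
  -- S3': coercivity
  exact H₃ η₁ hη₁ hη₁d a₀ θ₀ u₀ ha hθ hu hap hθp σ hσ hσhalf T ρ θ u hsol Φ ℓ hℓ t ht a b hab htrel

end RES

/-- **The crux `RelativeEnergyStability` of route `BoxDissipativeWeakStrong`, proved** (line `registered`, reshaped to the
clamped currency): the composition `RelativeEnergyStability_of` fed with the nine landed stubs of the line. -/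
theorem RelativeEnergyStability_proof :
    Summit.AtomisticToContinuum.HydrodynamicLimit.Theses.BoxDissipativeWeakStrong.RelativeEnergyStability :=
  RES.RelativeEnergyStability_of (fun h hτ => RES.clampAdmissible_mono h hτ) RES.stub_clampChoice
    RES.stub_clampedRelEnergyTimeZero RES.stub_boxBalanceLaws RES.stub_cutEosMaster RES.stub_localGibbsEnergyMoment
    RES.stub_forcedGronwall RES.stub_flowJointMeasurable RES.stub_clampedRelEnergyGronwall RES.stub_clampedRelEnergyCoercive

end Summit.AtomisticToContinuum.HydrodynamicLimit.Theorems

end
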